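import Summits.Ventures.HSemireg.HomComplexExact
import Literature.AlgebraicGeometry.Modules.VectorBundleFiniteLocallyFree
import Literature.AlgebraicGeometry.KTheory.GrothendieckGroup
import Mathlib.Algebra.Homology.BifunctorShift
import Mathlib.Algebra.Homology.HomotopyCategory.ShiftSequence
import Mathlib.Algebra.Homology.Single
import HarnessLib

/-!
# Venture HSemireg — the internal Hom complex, III: `𝓗om•(E•, –)` preserves quasi-isomorphisms for
# `E•` bounded and termwise finite locally free (strictly perfect)

HONEST FRAMING. Kernel plumbing for the cell `pub-hsemireg` (sequel to `HomComplex.lean`,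
`HomComplexExact.lean`; the «(f) part 2» lemma of the cell's blueprint, NOT a «K2 result»): proved
statements on real carriers; no hypothesis structures, no named facts, no claim about any variety;
nothing here bears on HC / HC_CM / HC_AV.

* `TopTrunc`: for a cochain complex `K ≤ b` in an abelian category, the top-degree piece
  `topι : K^b{b} ⟶ K` (Mathlib `mkHomFromSingle`), the short exact `truncSES K b = (topι, cokernel.π topι)`,
  its DEGREEWISE SPLITTINGS (`Splitting.ofIsIsoOfIsZero` in degree `b`, `ofIsZeroOfIsIso` elsewhere), and the
  amplitude of the quotient `trunc K b ∈ [a, b - 1]`.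
* `HomComplex.singleShiftIso : 𝓗om•(E₀{k}, F) ≅ 𝓗om•(E₀{0}, F)⟦k⟧` (from `dualComplex (E₀{k}) ≅
  (dualComplex (E₀{0}))⟦k⟧` — both differentials vanish — and Mathlib's shift-compatibility of
  `Functor.map₂CochainComplex`), natural in `F`; hence `quasiIso_map_singleAt` (base case in any degree).
* (a zero module is finite locally free: the landed `KTheory.KZero.isFiniteLocallyFree_of_isZero` is reused).
* **`HomComplex.quasiIso_map_of_bounded`**: `E• ∈ [a, b]` strictly, every `E^p` finite locally free,
  `φ : F• ⟶ F'•` a quasi-isomorphism ⟹ `𝓗om•(E•, φ)` is a quasi-isomorphism — induction on `b - a`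
  by the top truncation, `homShortComplex_shortExact`, `quasiIso_τ₂` and the one-term case.

NOT here: functoriality of the whole construction in `E•` up to homotopy, the descent of `𝓗om•(E•, –)` to
the derived category (cell probe `lean/PROBE-P3-K2-Descent.lean`), sections / `Γ`, traces.

References: The Stacks project, *More on Algebra*, Section «Hom complexes»; *Homological Algebra*, Section
«Truncation of complexes»; R. Hartshorne,
*Algebraic Geometry* (1977), II Ex. 5.1 (b), III.6. [StacksProject] [Hartshorne1977]
-/

noncomputable section

open CategoryTheory CategoryTheory.Limits AlgebraicGeometry Opposite

universe v' u' u

/-! ## §1 The top-degree truncation as a degreewise-split short exact sequence -/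

namespace Summit.Ventures.HSemireg.TopTrunc

variable {V : Type u'} [Category.{v'} V] [Abelian V] (K : CochainComplex V ℤ) (b : ℤ) [K.IsStrictlyLE b]

/-- The inclusion of the top-degree piece `K^b{b} ⟶ K` of a cochain complex `K ≤ b`. -/
def topι : (HomologicalComplex.single V (ComplexShape.up ℤ) b).obj (K.X b) ⟶ K :=
  HomologicalComplex.mkHomFromSingle (𝟙 (K.X b)) fun k hk =>
    (K.isZero_of_isStrictlyLE b k (by simp at hk; lia)).eq_of_tgt _ _

/-- In degree `b` the inclusion is the identification `K^b{b}^b ≅ K^b`. -/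
lemma topι_f_self : (topι K b).f b = (HomologicalComplex.singleObjXSelf (ComplexShape.up ℤ) b (K.X b)).hom := by
  rw [topι, HomologicalComplex.mkHomFromSingle_f, Category.comp_id]

/-- `topι` is an isomorphism in degree `b`. -/
instance isIso_topι_f_self : IsIso ((topι K b).f b) := by
  rw [topι_f_self]; infer_instance

/-- `topι` is a monomorphism. -/
instance mono_topι : Mono (topι K b) :=
  HomologicalComplex.mono_of_mono_f _ fun i => by
    by_cases hi : i = b
    · subst hi; infer_instance
    · exact (HomologicalComplex.isZero_single_obj_X (ComplexShape.up ℤ) b (K.X b) i hi).mono _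

/-- The truncation short complex `K^b{b} ↪ K ↠ coker`. -/
def truncSES : ShortComplex (CochainComplex V ℤ) :=
  ShortComplex.mk (topι K b) (cokernel.π (topι K b)) (cokernel.condition _)

/-- `K^b{b} ↪ K ↠ K/K^b{b}` is short exact. -/
lemma truncSES_shortExact : (truncSES K b).ShortExact where
  exact := ShortComplex.exact_of_g_is_cokernel _ (cokernelIsCokernel (topι K b))
  mono_f := mono_topι K b
  epi_g := by dsimp [truncSES]; infer_instance

/-- The truncated complex `K/K^b{b}` (degrees `< b` of `K`). -/
abbrev trunc : CochainComplex V ℤ := (truncSES K b).X₃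

/-- Degreewise short exactness. -/
lemma truncSES_map_eval_shortExact (m : ℤ) :
    ((truncSES K b).map (HomologicalComplex.eval V (ComplexShape.up ℤ) m)).ShortExact :=
  (HomologicalComplex.shortExact_iff_degreewise_shortExact _).1 (truncSES_shortExact K b) m

/-- In degree `b` the quotient vanishes. -/
lemma isZero_trunc_X_self : IsZero ((trunc K b).X b) :=
  ((truncSES_map_eval_shortExact K b b).isIso_f_iff).1 (isIso_topι_f_self K b)

/-- In degrees `m ≠ b` the quotient map `K^m ⟶ (K/K^b{b})^m` is an isomorphism. -/
lemma isIso_truncπ_f (m : ℤ) (hm : m ≠ b) : IsIso ((cokernel.π (topι K b)).f m) :=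
  ((truncSES_map_eval_shortExact K b m).isIso_g_iff).2
    (HomologicalComplex.isZero_single_obj_X (ComplexShape.up ℤ) b (K.X b) m hm)

/-- Degreewise splitting of the truncation sequence: in degree `b` by the inverse of `K^b{b}^b ≅ K^b`, in the other
degrees by the inverse of the quotient map. -/
def truncSESSplitting (m : ℤ) : ((truncSES K b).map (HomologicalComplex.eval V (ComplexShape.up ℤ) m)).Splitting :=
  if hm : m = b then
    ShortComplex.Splitting.ofIsIsoOfIsZero _ (by subst hm; exact isIso_topι_f_self K m)
      (by subst hm; exact isZero_trunc_X_self K m)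
  else
    ShortComplex.Splitting.ofIsZeroOfIsIso _
      (HomologicalComplex.isZero_single_obj_X (ComplexShape.up ℤ) b (K.X b) m hm) (isIso_truncπ_f K b m hm)

/-- The truncation is `≤ b - 1`. -/
instance trunc_isStrictlyLE : (trunc K b).IsStrictlyLE (b - 1) := by
  rw [CochainComplex.isStrictlyLE_iff]
  intro m hm
  by_cases hmb : m = b
  · subst hmb; exact isZero_trunc_X_self K m
  · haveI := isIso_truncπ_f K b m hmb
    exact (K.isZero_of_isStrictlyLE b m (by lia)).of_iso (asIso ((cokernel.π (topι K b)).f m)).symm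

/-- The truncation is `≥ a` if `K` is. -/
instance trunc_isStrictlyGE (a : ℤ) [K.IsStrictlyGE a] : (trunc K b).IsStrictlyGE a := by
  rw [CochainComplex.isStrictlyGE_iff]
  intro m hm
  by_cases hmb : m = b
  · subst hmb; exact isZero_trunc_X_self K m
  · haveI := isIso_truncπ_f K b m hmb
    exact (K.isZero_of_isStrictlyGE a m hm).of_iso (asIso ((cokernel.π (topι K b)).f m)).symm

end Summit.Ventures.HSemireg.TopTrunc

namespace Summit.Ventures.HSemireg

open Literature.AlgebraicGeometry.Modules Literature.AlgebraicGeometry.Motives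

variable (X : Scheme.{u})

namespace HomComplex

/-! ## §2 Base case in any degree `k` -/

section SingleShift

variable (E₀ : X.Modules) (k : ℤ)

/-- The module `E₀` as a complex concentrated in degree `k`. -/
abbrev singleAt : CochainComplex X.Modules ℤ := (HomologicalComplex.single X.Modules (ComplexShape.up ℤ) k).obj E₀

/-- The dual complex of `E₀{k}` has zero differential. -/
lemma dualComplex_singleAt_d (i j : ℤ) : (dualComplex X (singleAt X E₀ k)).d i j = 0 := by
  rw [dualComplex_d, HomologicalComplex.single_obj_d, smul_zero, op_zero]
  rfl

/-- Degree-`i` comparison `op (E₀{k}^{-i}) ≅ op (E₀{0}^{-(i+k)})`: both are `op E₀` for `i = -k` and zero otherwise. -/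
def dualSingleXIso (i : ℤ) :
    (dualComplex X (singleAt X E₀ k)).X i ≅ ((dualComplex X (single₀ X E₀))⟦k⟧).X i :=
  if hi : i = -k then
    ((HomologicalComplex.singleObjXIsoOfEq (ComplexShape.up ℤ) 0 E₀ (-(i + k)) (by lia)) ≪≫
      (HomologicalComplex.singleObjXIsoOfEq (ComplexShape.up ℤ) k E₀ (-i) (by lia)).symm).op
  else
    ((HomologicalComplex.isZero_single_obj_X (ComplexShape.up ℤ) k E₀ (-i) (by lia)).op).iso
      ((HomologicalComplex.isZero_single_obj_X (ComplexShape.up ℤ) 0 E₀ (-(i + k)) (by lia)).op)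

/-- `dualComplex (E₀{k}) ≅ (dualComplex (E₀{0}))⟦k⟧` (both have zero differential). -/
def dualSingleShiftIso : dualComplex X (singleAt X E₀ k) ≅ (dualComplex X (single₀ X E₀))⟦k⟧ :=
  HomologicalComplex.Hom.isoOfComponents (fun i => dualSingleXIso X E₀ k i) fun i j _ => by
    have h₁ : (dualComplex X (singleAt X E₀ k)).d i j = 0 := dualComplex_singleAt_d X E₀ k i j
    have h₂ : ((dualComplex X (single₀ X E₀))⟦k⟧).d i j = 0 := by
      rw [CochainComplex.shiftFunctor_obj_d', dualComplex_single₀_d, smul_zero]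
      rfl
    rw [h₁, h₂, zero_comp, comp_zero]

variable (F : CochainComplex X.Modules ℤ)

/-- `𝓗om•(E₀{k}, F) ≅ 𝓗om•(E₀{0}, F)⟦k⟧`. -/
def singleShiftIso : homComplex X (singleAt X E₀ k) F ≅ (homComplex X (single₀ X E₀) F)⟦k⟧ :=
  (((sheafHomBifunctor X).flip.map₂CochainComplex.obj F).mapIso (dualSingleShiftIso X E₀ k)) ≪≫
    (((sheafHomBifunctor X).flip.map₂CochainComplex.obj F).commShiftIso k).app (dualComplex X (single₀ X E₀))

variable {F} {F' : CochainComplex X.Modules ℤ} (φ : F ⟶ F')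

/-- Naturality of `singleShiftIso` in `F`. -/
lemma singleShiftIso_hom_naturality :
    map X (singleAt X E₀ k) φ ≫ (singleShiftIso X E₀ k F').hom =
      (singleShiftIso X E₀ k F).hom ≫ (map X (single₀ X E₀) φ)⟦k⟧' := by
  have h₁ := ((sheafHomBifunctor X).flip.map₂CochainComplex.map φ).naturality (dualSingleShiftIso X E₀ k).hom
  have h₂ := NatTrans.shift_app_comm ((sheafHomBifunctor X).flip.map₂CochainComplex.map φ) k
    (dualComplex X (single₀ X E₀))
  change ((sheafHomBifunctor X).flip.map₂CochainComplex.map φ).app (dualComplex X (singleAt X E₀ k)) ≫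
      ((sheafHomBifunctor X).flip.map₂CochainComplex.obj F').map (dualSingleShiftIso X E₀ k).hom ≫
        (((sheafHomBifunctor X).flip.map₂CochainComplex.obj F').commShiftIso k).hom.app
          (dualComplex X (single₀ X E₀)) =
    (((sheafHomBifunctor X).flip.map₂CochainComplex.obj F).map (dualSingleShiftIso X E₀ k).hom ≫
      (((sheafHomBifunctor X).flip.map₂CochainComplex.obj F).commShiftIso k).hom.app
        (dualComplex X (single₀ X E₀))) ≫
      (((sheafHomBifunctor X).flip.map₂CochainComplex.map φ).app (dualComplex X (single₀ X E₀)))⟦k⟧'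
  rw [← reassoc_of% h₁, ← h₂, Category.assoc]
  rfl

/-- **Base case in degree `k`**: for `E₀` finite locally free, `𝓗om•(E₀{k}, –)` preserves quasi-isomorphisms. -/
theorem quasiIso_map_singleAt (hE₀ : IsFiniteLocallyFree E₀) [QuasiIso φ] :
    QuasiIso (map X (singleAt X E₀ k) φ) := by
  haveI := quasiIso_map_single₀ X E₀ φ hE₀
  refine quasiIso_of_arrow_mk_iso ((map X (single₀ X E₀) φ)⟦k⟧') (map X (singleAt X E₀ k) φ)
    (Arrow.isoMk (singleShiftIso X E₀ k F).symm (singleShiftIso X E₀ k F').symm ?_)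
  change (singleShiftIso X E₀ k F).inv ≫ map X (singleAt X E₀ k) φ =
    (map X (single₀ X E₀) φ)⟦k⟧' ≫ (singleShiftIso X E₀ k F').inv
  rw [Iso.inv_comp_eq, ← Category.assoc, Iso.eq_comp_inv, singleShiftIso_hom_naturality]

end SingleShift

/-! ## §3 The theorem -/

section Bounded

open Literature.AlgebraicGeometry.Motives

variable {F F' : CochainComplex X.Modules ℤ} (φ : F ⟶ F')

/-- A morphism `𝓗om•(E•, φ)` with `E•` degreewise zero is a quasi-isomorphism (both sides are zero). -/
lemma quasiIso_map_of_isZero (E : CochainComplex X.Modules ℤ) (hE : ∀ p, IsZero (E.X p)) :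
    QuasiIso (map X E φ) := by
  rw [quasiIso_iff]
  intro n
  rw [quasiIsoAt_iff_isIso_homologyMap]
  have h₁ : IsZero ((homComplex X E F).homology n) := (HomologicalComplex.ExactAt.of_isZero
    (isZero_X X E F n fun q i _ => isZero_sheafHom_of_isZero (hE (-i)) _)).isZero_homology
  have h₂ : IsZero ((homComplex X E F').homology n) := (HomologicalComplex.ExactAt.of_isZero
    (isZero_X X E F' n fun q i _ => isZero_sheafHom_of_isZero (hE (-i)) _)).isZero_homology
  exact ⟨⟨0, h₁.eq_of_src _ _, h₂.eq_of_src _ _⟩⟩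

/-- Induction on the amplitude. -/
lemma quasiIso_map_of_bounded_aux [QuasiIso φ] (m : ℕ) :
    ∀ (E : CochainComplex X.Modules ℤ) (a b : ℤ), b - a < m → E.IsStrictlyGE a → E.IsStrictlyLE b →
      (∀ p, IsFiniteLocallyFree (E.X p)) → QuasiIso (map X E φ) := by
  induction m with
  | zero =>
    intro E a b hab _ _ hE
    exact quasiIso_map_of_isZero X φ E fun p => by
      by_cases hp : p < a
      · exact E.isZero_of_isStrictlyGE a p hp
      · exact E.isZero_of_isStrictlyLE b p (by lia)
  | succ m ih =>
    intro E a b hab _ _ hE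
    haveI : QuasiIso (map X (TopTrunc.truncSES E b).X₃ φ) :=
      ih _ a (b - 1) (by lia) inferInstance inferInstance fun p => by
        by_cases hp : p = b
        · subst hp
          exact Literature.AlgebraicGeometry.KTheory.KZero.isFiniteLocallyFree_of_isZero
            (TopTrunc.isZero_trunc_X_self E p)
        · exact isFiniteLocallyFree_of_iso
            (@asIso _ _ _ _ ((cokernel.π (TopTrunc.topι E b)).f p) (TopTrunc.isIso_truncπ_f E b p hp)) (hE p)
    haveI : QuasiIso (map X (TopTrunc.truncSES E b).X₁ φ) := quasiIso_map_singleAt X (E.X b) b φ (hE b)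
    exact quasiIso_map_of_degreewiseSplit X (TopTrunc.truncSES E b) φ (TopTrunc.truncSESSplitting E b)
      inferInstance inferInstance

/-- **`𝓗om•(E•, –)` preserves quasi-isomorphisms for `E•` bounded and termwise finite locally free**
(strictly perfect): if `E• ∈ [a, b]` strictly with every `E^p` finite locally free and `φ : F• ⟶ F'•` is a
quasi-isomorphism, then `𝓗om•(E•, φ)` is a quasi-isomorphism. Proof: induction on `b - a` by the top-degree
truncation `E^b{b} ↪ E• ↠ E•/E^b{b}` (degreewise split), the degreewise-split short exactness of the Hom
short complexes, two-out-of-three for quasi-isomorphisms, and the one-term case (`𝓗om(E^b, –)` exact).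
[cite: Hartshorne1977, II Ex. 5.1 (b) and III.6 (proof of Prop. 6.5)] -/
theorem quasiIso_map_of_bounded (E : CochainComplex X.Modules ℤ) (a b : ℤ) [E.IsStrictlyGE a] [E.IsStrictlyLE b]
    (hE : ∀ p, IsFiniteLocallyFree (E.X p)) [QuasiIso φ] : QuasiIso (map X E φ) :=
  quasiIso_map_of_bounded_aux X φ (b - a).toNat.succ E a b (by lia) inferInstance inferInstance hE

end Bounded

end HomComplex

end Summit.Ventures.HSemireg

end
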